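import Mathlib
import Summits.Langlands.Langlands.Theorems.SkinnerWilesDefectOneReducibleOrdinaryProModularConnectednessComponentsAux

/-!
# Grothendieck's connectedness theorem, (G1): reduction of (a_{k−m}), (b_{k−m}) to the components

Route `SkinnerWilesDefectOne`, crux `ReducibleOrdinaryProModular` (stmt-Langlands-12919), line
`fine-selmer-codimension-two`, registered stub (R) `stub_raynaudConnectedness`; sub-goal (G1)
`stub_raynaudConnectedness_auxComponents` of the programme proving Grothendieck's connectedness theorem
[SGA2 XIII 2.1] = `Literature.RingTheory.LocalCohomology.GrothendieckConnectedness`.  Grothendieck's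
proof opens with "on est ramené au cas où `X` est intègre"; this file makes that reduction explicit and
sorry-free.  Let `A` be a complete Noetherian local ring satisfying (a_k) (every minimal prime `P` has
`dim A/P ≥ k + 2`) and (b_k) (crossing form: two-coloured `Min A` has a crossing `C₁ + C₂` of
dimension `≥ k + 1`), `f₁, …, f_m ∈ 𝔪`, `m ≤ k`, `J = (f₁,…,f_m)`.  GRANTED
(A1) the domain case of (a): in a complete Noetherian local domain `D` with `e + m ≤ dim D` every
  minimal prime `Q` of `D/(f₁,…,f_m)` has `dim ≥ e` (registered sub-goal
  `stub_raynaudConnectedness_auxDomainComponentDim`, a hypothesis of (G1)), and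
(dom) the crossing property in dimension `k − m + 1` of `(A/P)/(f̄)` for every minimal prime `P` of `A`
  (the domain case of (b), again a hypothesis of (G1)),
we prove (a_{k−m}) and (b_{k−m}) for `B = A/J`:

* (a) a minimal prime `Q` of `B` pulls back to `Q' ⊇ P` minimal over `P + J` for a minimal prime `P`
  of `A`; the domain step (`Theorems.le_ringKrullDim_quotient_of_mem_minimalPrimes_sup_ofList`, from
  (A1) in `D = A/P`) gives `dim A/Q' ≥ k − m + 2`.
* (b) by contradiction: if a two-colouring `S` of `Min B` has only small crossings, call a prime
  `𝔫 ⊇ J` of `A` `S`-reachable (`Sᶜ`-reachable) if it contains the pull-back of an `S`-coloured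
  (`Sᶜ`-coloured) minimal prime of `B`.  KEY 1: a prime of coheight `≥ k − m + 1` is reachable from
  exactly one side.  KEY 2 (`Theorems.false_of_reach_of_mem_minimalPrimes_sup`, **monochromatic
  components**): for `P ∈ Min A` all primes minimal over `P + J` are reachable from the same side —
  else (dom) applied to the reachability colouring of `Spec (A/P)/(f̄)` produces a crossing of coheight
  `≥ k − m + 1` reachable from both sides.  KEY 3/4 (`Theorems.false_of_colouring_of_reach`): colour
  `Min A` by the side of its components; both colours occur, so (b_k) gives minimal `P_i, P_j` of
  different sides and a prime `𝔯 ⊇ P_i + P_j` of coheight `≥ k + 1`; the domain step in `A/𝔯`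
  (e = k + 1 − m) gives a prime `𝔫 ⊇ 𝔯 + J` of coheight `≥ k − m + 1` containing components through
  `P_i` and through `P_j`, hence reachable from both sides — contradicting KEY 1.

* `FineSelmerCodimensionTwo.stub_raynaudConnectedness_auxComponents` — the REGISTERED sub-goal (G1),
  signature verbatim.

References: A. Grothendieck, SGA 2, Exp. XIII Thm. 2.1 [Grothendieck1968SGA2]; M. Brodmann, R. Sharp,
*Local cohomology*, CUP 1998, 19.2.8–19.2.12 [BrodmannSharp1998]; C. Skinner, A. Wiles, Publ. Math.
IHÉS 89 (1999), App. A [SkinnerWiles1999].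
-/

set_option linter.dupNamespace false -- project-wide option (lakefile weak.linter.dupNamespace); `Summit.Langlands.Langlands` is the mandated namespace
set_option autoImplicit false

namespace Summit.Langlands.Langlands.Theorems

open IsLocalRing

universe u

variable {A : Type u} [CommRing A]

/-! ## 1. KEY 2: the components of `V(P) ∩ V(f₁,…,f_m)` are monochromatic -/

/-- **Monochromatic components (KEY 2 of the reduction to the integral case in SGA2 XIII 2.1).**
Abstract form: `RS`, `RT` are monotone predicates on ideals ("reachable from side `S` / `Sᶜ`") covering
the primes above `J = (f₁,…,f_m)`, no prime of coheight `≥ n` satisfies both (KEY 1), every prime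
minimal over `P + J` has coheight `≥ n`, and `Spec (A/P)/(f̄)` has the crossing property in dimension
`n`.  Then no two primes minimal over `P + J` are reachable from different sides: otherwise the
colouring "pull-back is `S`-reachable" of `Spec (A/P)/(f̄)` uses both colours on minimal primes, the
crossing it yields pulls back (along `θ_P`, kernel `P + J`) to an ideal of coheight `≥ n` below primes
reachable from both sides — contradicting KEY 1 at a prime realising that coheight.
[cite: Grothendieck1968SGA2, Exp. XIII Thm. 2.1] -/
theorem false_of_reach_of_mem_minimalPrimes_sup (fs : List A) {P : Ideal A} {n : ℕ}
    (RS RT : Ideal A → Prop)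
    (hmonoS : ∀ q q' : Ideal A, RS q → q ≤ q' → RS q')
    (hmonoT : ∀ q q' : Ideal A, RT q → q ≤ q' → RT q')
    (hcover : ∀ q : Ideal A, q.IsPrime → Ideal.ofList fs ≤ q → RS q ∨ RT q)
    (hkey1 : ∀ q : Ideal A, q.IsPrime → RS q → RT q →
      (n : WithBot ℕ∞) ≤ ringKrullDim (A ⧸ q) → False)
    (hdimW : ∀ W ∈ (P ⊔ Ideal.ofList fs).minimalPrimes, (n : WithBot ℕ∞) ≤ ringKrullDim (A ⧸ W))
    (hdom : ∀ S : Set (PrimeSpectrum ((A ⧸ P) ⧸ Ideal.ofList (fs.map (Ideal.Quotient.mk P)))),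
      (∃ C ∈ S, C.asIdeal ∈ minimalPrimes ((A ⧸ P) ⧸ Ideal.ofList (fs.map (Ideal.Quotient.mk P)))) →
      (∃ C ∉ S, C.asIdeal ∈ minimalPrimes ((A ⧸ P) ⧸ Ideal.ofList (fs.map (Ideal.Quotient.mk P)))) →
        ∃ C₁ ∈ S, ∃ C₂ ∉ S,
          C₁.asIdeal ∈ minimalPrimes ((A ⧸ P) ⧸ Ideal.ofList (fs.map (Ideal.Quotient.mk P))) ∧
          C₂.asIdeal ∈ minimalPrimes ((A ⧸ P) ⧸ Ideal.ofList (fs.map (Ideal.Quotient.mk P))) ∧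
          (n : WithBot ℕ∞) ≤ ringKrullDim (((A ⧸ P) ⧸ Ideal.ofList (fs.map (Ideal.Quotient.mk P))) ⧸
            (C₁.asIdeal ⊔ C₂.asIdeal)))
    {W₁ W₂ : Ideal A} (hW₁ : W₁ ∈ (P ⊔ Ideal.ofList fs).minimalPrimes)
    (hW₂ : W₂ ∈ (P ⊔ Ideal.ofList fs).minimalPrimes) (h₁ : RS W₁) (h₂ : RT W₂) : False := by
  have hθ := quotQuotOfList_surjective P fs
  -- `W₂` is not `S`-reachable (KEY 1)
  have hW₂S : ¬ RS W₂ := fun h => hkey1 W₂ hW₂.1.1 h h₂ (hdimW W₂ hW₂)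
  -- `Wᵢ = θ⁻¹ Qᵢ` for minimal primes `Qᵢ` of `(A/P)/(f̄)`
  obtain ⟨Q₁, hQ₁, rfl⟩ := (mem_minimalPrimes_sup_ofList_iff P fs W₁).mp hW₁
  obtain ⟨Q₂, hQ₂, rfl⟩ := (mem_minimalPrimes_sup_ofList_iff P fs W₂).mp hW₂
  -- colour `Spec (A/P)/(f̄)` by `S`-reachability of the pull-back; both colours occur on `Min`
  let SP : Set (PrimeSpectrum ((A ⧸ P) ⧸ Ideal.ofList (fs.map (Ideal.Quotient.mk P)))) :=
    {C | RS (C.asIdeal.comap ((Ideal.Quotient.mk (Ideal.ofList (fs.map (Ideal.Quotient.mk P)))).comp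
      (Ideal.Quotient.mk P)))}
  have hS₁ : ∃ C ∈ SP, C.asIdeal ∈ minimalPrimes ((A ⧸ P) ⧸ Ideal.ofList (fs.map (Ideal.Quotient.mk P))) :=
    ⟨⟨Q₁, hQ₁.1.1⟩, h₁, hQ₁⟩
  have hS₂ : ∃ C ∉ SP, C.asIdeal ∈ minimalPrimes ((A ⧸ P) ⧸ Ideal.ofList (fs.map (Ideal.Quotient.mk P))) :=
    ⟨⟨Q₂, hQ₂.1.1⟩, hW₂S, hQ₂⟩
  obtain ⟨C₁, hC₁S, C₂, hC₂S, -, hC₂, hdim⟩ := hdom SP hS₁ hS₂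
  -- `θ⁻¹ C₂` is minimal over `P + J` and not `S`-reachable, hence `Sᶜ`-reachable
  have hW₂' := (mem_minimalPrimes_sup_ofList_iff P fs _).mpr ⟨_, hC₂, rfl⟩
  have hRT : RT (C₂.asIdeal.comap ((Ideal.Quotient.mk (Ideal.ofList (fs.map (Ideal.Quotient.mk P)))).comp
      (Ideal.Quotient.mk P))) := by
    rcases hcover _ hW₂'.1.1 (le_sup_right.trans hW₂'.1.2) with h | h
    · exact absurd h hC₂S
    · exact h
  -- a prime `𝔫 ⊇ θ⁻¹(C₁ + C₂)` realising `n ≤ dim` is reachable from both sides: contradiction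
  rw [← ringKrullDim_quotient_comap_eq_of_surjective hθ] at hdim
  obtain ⟨𝔫, h𝔫, hdim𝔫⟩ := exists_minimalPrimes_le_ringKrullDim_quotient _ _ hdim
  exact hkey1 𝔫.asIdeal h𝔫.1.1 (hmonoS _ _ hC₁S ((Ideal.comap_mono le_sup_left).trans h𝔫.1.2))
    (hmonoT _ _ hRT ((Ideal.comap_mono le_sup_right).trans h𝔫.1.2)) hdim𝔫

/-! ## 2. KEY 3/4: the induced colouring of `Min A` and the final contradiction -/

/-- **Assembly of the reduction to the integral case (KEY 3 and KEY 4).**  With `RS`, `RT` as in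
`false_of_reach_of_mem_minimalPrimes_sup` (monotone, covering the primes above `J = (f₁,…,f_m)`, KEY 1
in coheight `n`, KEY 2 for every minimal prime of `A`), the crossing property (b_k) of `A`, the domain
step at coheight `k + 1` ("every prime minimal over `𝔯 + J` has coheight `≥ n` when `dim A/𝔯 ≥ k + 1`")
and both sides occurring among the primes minimal over `J`, we reach a contradiction: colour a minimal
prime `P` of `A` by "`V(P) ∩ V(J)` has an `S`-reachable component"; both colours occur (KEY 2), (b_k)
gives minimal `P_i`, `P_j` of different colours and a prime `𝔯 ⊇ P_i + P_j` of coheight `≥ k + 1`,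
and a prime `𝔫` minimal over `𝔯 + J` has coheight `≥ n` and lies above components through `P_i`
(`S`-reachable by KEY 2) and through `P_j` (`Sᶜ`-reachable) — contradicting KEY 1.
[cite: Grothendieck1968SGA2, Exp. XIII Thm. 2.1] -/
theorem false_of_colouring_of_reach [IsLocalRing A] (fs : List A)
    (hJm : Ideal.ofList fs ≤ maximalIdeal A) {n k : ℕ} (RS RT : Ideal A → Prop)
    (hmonoS : ∀ q q' : Ideal A, RS q → q ≤ q' → RS q')
    (hmonoT : ∀ q q' : Ideal A, RT q → q ≤ q' → RT q')
    (hcover : ∀ q : Ideal A, q.IsPrime → Ideal.ofList fs ≤ q → RS q ∨ RT q)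
    (hkey1 : ∀ q : Ideal A, q.IsPrime → RS q → RT q →
      (n : WithBot ℕ∞) ≤ ringKrullDim (A ⧸ q) → False)
    (hkey2 : ∀ P ∈ minimalPrimes A, ∀ W₁ ∈ (P ⊔ Ideal.ofList fs).minimalPrimes,
      ∀ W₂ ∈ (P ⊔ Ideal.ofList fs).minimalPrimes, RS W₁ → RT W₂ → False)
    (hbk : ∀ S : Set (PrimeSpectrum A), (∃ C ∈ S, C.asIdeal ∈ minimalPrimes A) →
      (∃ C ∉ S, C.asIdeal ∈ minimalPrimes A) →
        ∃ C₁ ∈ S, ∃ C₂ ∉ S, C₁.asIdeal ∈ minimalPrimes A ∧ C₂.asIdeal ∈ minimalPrimes A ∧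
          ((k + 1 : ℕ) : WithBot ℕ∞) ≤ ringKrullDim (A ⧸ (C₁.asIdeal ⊔ C₂.asIdeal)))
    (hstep : ∀ 𝔯 : Ideal A, 𝔯.IsPrime → ((k + 1 : ℕ) : WithBot ℕ∞) ≤ ringKrullDim (A ⧸ 𝔯) →
      ∀ 𝔫 ∈ (𝔯 ⊔ Ideal.ofList fs).minimalPrimes, (n : WithBot ℕ∞) ≤ ringKrullDim (A ⧸ 𝔫))
    (hS : ∃ q ∈ (Ideal.ofList fs).minimalPrimes, RS q)
    (hT : ∃ q ∈ (Ideal.ofList fs).minimalPrimes, RT q) : False := by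
  -- the induced colouring of `Min A`: "`V(P) ∩ V(J)` has an `S`-reachable component"
  let SA : Set (PrimeSpectrum A) := {p | ∃ W ∈ (p.asIdeal ⊔ Ideal.ofList fs).minimalPrimes, RS W}
  -- KEY 3: both colours occur among the minimal primes of `A`
  have h₁ : ∃ C ∈ SA, C.asIdeal ∈ minimalPrimes A := by
    obtain ⟨q, hq, hRS⟩ := hS
    haveI := hq.1.1
    obtain ⟨P, hP, hPq⟩ := Ideal.exists_minimalPrimes_le (show (⊥ : Ideal A) ≤ q from bot_le)
    refine ⟨⟨P, hP.1.1⟩, ?_, hP⟩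
    show ∃ W ∈ (P ⊔ Ideal.ofList fs).minimalPrimes, RS W
    exact ⟨q, mem_minimalPrimes_of_le_of_le hq le_sup_right (sup_le hPq hq.1.2), hRS⟩
  have h₂ : ∃ C ∉ SA, C.asIdeal ∈ minimalPrimes A := by
    obtain ⟨q, hq, hRT⟩ := hT
    haveI := hq.1.1
    obtain ⟨P, hP, hPq⟩ := Ideal.exists_minimalPrimes_le (show (⊥ : Ideal A) ≤ q from bot_le)
    refine ⟨⟨P, hP.1.1⟩, ?_, hP⟩
    intro hmem
    obtain ⟨W, hW, hRSW⟩ :=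
      (show ∃ W ∈ (P ⊔ Ideal.ofList fs).minimalPrimes, RS W from hmem)
    exact hkey2 P hP W hW q (mem_minimalPrimes_of_le_of_le hq le_sup_right (sup_le hPq hq.1.2))
      hRSW hRT
  -- KEY 4: a big crossing of `A` between the two colour classes …
  obtain ⟨C₁, hC₁S, C₂, hC₂S, hC₁, -, hdim⟩ := hbk SA h₁ h₂
  obtain ⟨𝔯, h𝔯, hdim𝔯⟩ := exists_minimalPrimes_le_ringKrullDim_quotient _ _ hdim
  -- … a component of `V(𝔯) ∩ V(J)` of coheight `≥ n` (domain step in `A/𝔯`) …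
  obtain ⟨𝔫, h𝔫, -⟩ := Ideal.exists_minimalPrimes_le
    (show 𝔯.asIdeal ⊔ Ideal.ofList fs ≤ maximalIdeal A from
      sup_le (le_maximalIdeal 𝔯.isPrime.ne_top) hJm)
  have hn𝔫 : (n : WithBot ℕ∞) ≤ ringKrullDim (A ⧸ 𝔫) := hstep 𝔯.asIdeal 𝔯.isPrime hdim𝔯 𝔫 h𝔫
  haveI := h𝔫.1.1
  have hJ𝔫 : Ideal.ofList fs ≤ 𝔫 := le_sup_right.trans h𝔫.1.2
  have h𝔯𝔫 : C₁.asIdeal ⊔ C₂.asIdeal ≤ 𝔫 := h𝔯.1.2.trans (le_sup_left.trans h𝔫.1.2)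
  -- … lies above components through `C₁` and through `C₂`
  obtain ⟨W₁, hW₁, hW₁𝔫⟩ := Ideal.exists_minimalPrimes_le
    (show C₁.asIdeal ⊔ Ideal.ofList fs ≤ 𝔫 from sup_le (le_sup_left.trans h𝔯𝔫) hJ𝔫)
  obtain ⟨W₂, hW₂, hW₂𝔫⟩ := Ideal.exists_minimalPrimes_le
    (show C₂.asIdeal ⊔ Ideal.ofList fs ≤ 𝔫 from sup_le (le_sup_right.trans h𝔯𝔫) hJ𝔫)
  -- every component through `C₁` is `S`-reachable (KEY 2), none through `C₂` is
  have hRS₁ : RS W₁ := by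
    obtain ⟨W, hW, hRSW⟩ :=
      (show ∃ W ∈ (C₁.asIdeal ⊔ Ideal.ofList fs).minimalPrimes, RS W from hC₁S)
    rcases hcover W₁ hW₁.1.1 (le_sup_right.trans hW₁.1.2) with h | h
    · exact h
    · exact (hkey2 C₁.asIdeal hC₁ W hW W₁ hW₁ hRSW h).elim
  have hRT₂ : RT W₂ := by
    rcases hcover W₂ hW₂.1.1 (le_sup_right.trans hW₂.1.2) with h | h
    · exact (hC₂S (show ∃ W ∈ (C₂.asIdeal ⊔ Ideal.ofList fs).minimalPrimes, RS W from
        ⟨W₂, hW₂, h⟩)).elim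
    · exact h
  exact hkey1 𝔫 h𝔫.1.1 (hmonoS _ _ hRS₁ hW₁𝔫) (hmonoT _ _ hRT₂ hW₂𝔫) hn𝔫

end Summit.Langlands.Langlands.Theorems

/-! ## 3. The registered sub-goal (G1) (verbatim signature) -/

namespace Summit.Langlands.Langlands.Cruxes.ReducibleOrdinaryProModular.FineSelmerCodimensionTwo

open IsLocalRing

/-- **Registered sub-goal (G1) `stub_raynaudConnectedness_auxComponents` of stub (R)
`stub_raynaudConnectedness`** — Grothendieck's "on est ramené au cas où `X` est intègre" in the proof
of SGA2 XIII 2.1: granted (A1) (the dimension statement for complete local DOMAINS, registered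
sub-goal `stub_raynaudConnectedness_auxDomainComponentDim`) and the crossing property of the integral
components `(A/P)/(f̄₁,…,f̄_m)` in dimension `k − m + 1`, a complete Noetherian local ring `A` with
(a_k), (b_k) and `f₁, …, f_m ∈ 𝔪`, `m ≤ k`, has `A/(f₁,…,f_m)` satisfying (a_{k−m}) and (b_{k−m}).
Part (a): `Theorems.le_ringKrullDim_quotient_of_mem_minimalPrimes_sup_ofList`; part (b): KEY 1–4
(`Theorems.false_of_reach_of_mem_minimalPrimes_sup`, `Theorems.false_of_colouring_of_reach`) for the
reachability predicates of the given colouring. [cite: Grothendieck1968SGA2, Exp. XIII Thm. 2.1] -/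
theorem stub_raynaudConnectedness_auxComponents :
    (∀ (D : Type) [CommRing D] [IsDomain D] [IsNoetherianRing D] [IsLocalRing D]
      [IsAdicComplete (IsLocalRing.maximalIdeal D) D] (fs : List D) (e : ℕ),
      (∀ f ∈ fs, f ∈ IsLocalRing.maximalIdeal D) → ((e + fs.length : ℕ) : WithBot ℕ∞) ≤ ringKrullDim D →
      ∀ Q : Ideal (D ⧸ Ideal.ofList fs), Q ∈ minimalPrimes (D ⧸ Ideal.ofList fs) →
        (e : WithBot ℕ∞) ≤ ringKrullDim ((D ⧸ Ideal.ofList fs) ⧸ Q)) →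
    ∀ (A : Type) [CommRing A] [IsNoetherianRing A] [IsLocalRing A]
      [IsAdicComplete (IsLocalRing.maximalIdeal A) A] (k : ℕ) (fs : List A), 1 ≤ k →
      (∀ f ∈ fs, f ∈ IsLocalRing.maximalIdeal A) → fs.length ≤ k →
      (∀ P : Ideal A, P ∈ minimalPrimes A → ((k + 2 : ℕ) : WithBot ℕ∞) ≤ ringKrullDim (A ⧸ P)) →
      (∀ S : Set (PrimeSpectrum A), (∃ C ∈ S, C.asIdeal ∈ minimalPrimes A) →
        (∃ C ∉ S, C.asIdeal ∈ minimalPrimes A) →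
          ∃ C₁ ∈ S, ∃ C₂ ∉ S, C₁.asIdeal ∈ minimalPrimes A ∧ C₂.asIdeal ∈ minimalPrimes A ∧
            ((k + 1 : ℕ) : WithBot ℕ∞) ≤ ringKrullDim (A ⧸ (C₁.asIdeal ⊔ C₂.asIdeal))) →
      (∀ P : Ideal A, P ∈ minimalPrimes A →
        ∀ S : Set (PrimeSpectrum ((A ⧸ P) ⧸ Ideal.ofList (fs.map (Ideal.Quotient.mk P)))),
          (∃ C ∈ S, C.asIdeal ∈ minimalPrimes ((A ⧸ P) ⧸ Ideal.ofList (fs.map (Ideal.Quotient.mk P)))) →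
          (∃ C ∉ S, C.asIdeal ∈ minimalPrimes ((A ⧸ P) ⧸ Ideal.ofList (fs.map (Ideal.Quotient.mk P)))) →
            ∃ C₁ ∈ S, ∃ C₂ ∉ S,
              C₁.asIdeal ∈ minimalPrimes ((A ⧸ P) ⧸ Ideal.ofList (fs.map (Ideal.Quotient.mk P))) ∧
              C₂.asIdeal ∈ minimalPrimes ((A ⧸ P) ⧸ Ideal.ofList (fs.map (Ideal.Quotient.mk P))) ∧
              ((k - fs.length + 1 : ℕ) : WithBot ℕ∞) ≤
                ringKrullDim (((A ⧸ P) ⧸ Ideal.ofList (fs.map (Ideal.Quotient.mk P))) ⧸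
                  (C₁.asIdeal ⊔ C₂.asIdeal))) →
      (∀ Q : Ideal (A ⧸ Ideal.ofList fs), Q ∈ minimalPrimes (A ⧸ Ideal.ofList fs) →
          ((k - fs.length + 2 : ℕ) : WithBot ℕ∞) ≤ ringKrullDim ((A ⧸ Ideal.ofList fs) ⧸ Q)) ∧
      (∀ S : Set (PrimeSpectrum (A ⧸ Ideal.ofList fs)),
          (∃ C ∈ S, C.asIdeal ∈ minimalPrimes (A ⧸ Ideal.ofList fs)) →
          (∃ C ∉ S, C.asIdeal ∈ minimalPrimes (A ⧸ Ideal.ofList fs)) →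
            ∃ C₁ ∈ S, ∃ C₂ ∉ S, C₁.asIdeal ∈ minimalPrimes (A ⧸ Ideal.ofList fs) ∧
              C₂.asIdeal ∈ minimalPrimes (A ⧸ Ideal.ofList fs) ∧
              ((k - fs.length + 1 : ℕ) : WithBot ℕ∞) ≤
                ringKrullDim ((A ⧸ Ideal.ofList fs) ⧸ (C₁.asIdeal ⊔ C₂.asIdeal))) := by
  intro hA1 A _ _ _ _ k fs _hk hfs hm hak hbk hdom
  -- `J = (f₁,…,f_m) ≤ 𝔪`, `π : A ↠ A/J`
  have hJm : Ideal.ofList fs ≤ maximalIdeal A := Ideal.span_le.mpr fun f hf => hfs f hf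
  have hπ : Function.Surjective (Ideal.Quotient.mk (Ideal.ofList fs)) := Ideal.Quotient.mk_surjective
  have hkerπ : RingHom.ker (Ideal.Quotient.mk (Ideal.ofList fs)) = Ideal.ofList fs := Ideal.mk_ker
  -- the domain step, at an arbitrary prime and at a minimal prime of `A`
  have hstep : ∀ P : Ideal A, P.IsPrime → ∀ e : ℕ,
      ((e + fs.length : ℕ) : WithBot ℕ∞) ≤ ringKrullDim (A ⧸ P) →
      ∀ q ∈ (P ⊔ Ideal.ofList fs).minimalPrimes, (e : WithBot ℕ∞) ≤ ringKrullDim (A ⧸ q) :=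
    fun P hP e he q hq =>
      Summit.Langlands.Langlands.Theorems.le_ringKrullDim_quotient_of_mem_minimalPrimes_sup_ofList
        hA1 hfs hP he hq
  have hstepMin : ∀ P ∈ minimalPrimes A, ∀ q ∈ (P ⊔ Ideal.ofList fs).minimalPrimes,
      ((k - fs.length + 2 : ℕ) : WithBot ℕ∞) ≤ ringKrullDim (A ⧸ q) := by
    intro P hP q hq
    refine hstep P hP.1.1 _ ?_ q hq
    rw [show k - fs.length + 2 + fs.length = k + 2 by omega]
    exact hak P hP
  refine ⟨?_, ?_⟩
  · -- (a_{k−m}): pull `Q` back to `A`, put a minimal prime `P` of `A` below it, domain step in `A/P`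
    intro Q hQ
    have hQ' : Q.comap (Ideal.Quotient.mk (Ideal.ofList fs)) ∈ (Ideal.ofList fs).minimalPrimes :=
      Summit.Langlands.Langlands.Theorems.comap_mem_minimalPrimes_of_quotient hQ
    haveI := hQ'.1.1
    obtain ⟨P, hP, hPQ⟩ := Ideal.exists_minimalPrimes_le
      (show (⊥ : Ideal A) ≤ Q.comap (Ideal.Quotient.mk (Ideal.ofList fs)) from bot_le)
    rw [← Summit.Langlands.Langlands.Theorems.ringKrullDim_quotient_comap_eq_of_surjective hπ]
    exact hstepMin P hP _ (Summit.Langlands.Langlands.Theorems.mem_minimalPrimes_of_le_of_le hQ'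
      le_sup_right (sup_le hPQ hQ'.1.2))
  · -- (b_{k−m}), by contradiction
    intro S hS₁ hS₂
    by_contra H
    push Not at H
    -- reachability from side `S` / side `Sᶜ`
    let RS : Ideal A → Prop := fun q => ∃ C ∈ S, C.asIdeal ∈ minimalPrimes (A ⧸ Ideal.ofList fs) ∧
      C.asIdeal.comap (Ideal.Quotient.mk (Ideal.ofList fs)) ≤ q
    let RT : Ideal A → Prop := fun q => ∃ C ∉ S, C.asIdeal ∈ minimalPrimes (A ⧸ Ideal.ofList fs) ∧
      C.asIdeal.comap (Ideal.Quotient.mk (Ideal.ofList fs)) ≤ q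
    have hmonoS : ∀ q q' : Ideal A, RS q → q ≤ q' → RS q' :=
      fun q q' ⟨C, hCS, hC, hCq⟩ hqq' => ⟨C, hCS, hC, hCq.trans hqq'⟩
    have hmonoT : ∀ q q' : Ideal A, RT q → q ≤ q' → RT q' :=
      fun q q' ⟨C, hCS, hC, hCq⟩ hqq' => ⟨C, hCS, hC, hCq.trans hqq'⟩
    -- every prime above `J` is reachable from some side
    have hcover : ∀ q : Ideal A, q.IsPrime → Ideal.ofList fs ≤ q → RS q ∨ RT q := by
      intro q hq hJq
      have hker : RingHom.ker (Ideal.Quotient.mk (Ideal.ofList fs)) ≤ q := by rwa [hkerπ]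
      haveI : (q.map (Ideal.Quotient.mk (Ideal.ofList fs))).IsPrime :=
        Ideal.map_isPrime_of_surjective hπ hker
      obtain ⟨C, hC, hCq⟩ := Ideal.exists_minimalPrimes_le
        (show (⊥ : Ideal (A ⧸ Ideal.ofList fs)) ≤ q.map (Ideal.Quotient.mk (Ideal.ofList fs)) from
          bot_le)
      have hCq' : C.comap (Ideal.Quotient.mk (Ideal.ofList fs)) ≤ q := by
        refine (Ideal.comap_mono hCq).trans ?_
        rw [Ideal.comap_map_of_surjective' _ hπ, sup_eq_left.mpr hker]
      by_cases hCS : (⟨C, hC.1.1⟩ : PrimeSpectrum (A ⧸ Ideal.ofList fs)) ∈ S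
      · exact Or.inl ⟨_, hCS, hC, hCq'⟩
      · exact Or.inr ⟨_, hCS, hC, hCq'⟩
    -- KEY 1: no prime of coheight `≥ k − m + 1` is reachable from both sides
    have hkey1 : ∀ q : Ideal A, q.IsPrime → RS q → RT q →
        ((k - fs.length + 1 : ℕ) : WithBot ℕ∞) ≤ ringKrullDim (A ⧸ q) → False := by
      rintro q - ⟨C₁, hC₁S, hC₁, hC₁q⟩ ⟨C₂, hC₂S, hC₂, hC₂q⟩ hnq
      have hker : RingHom.ker (Ideal.Quotient.mk (Ideal.ofList fs)) ≤ q :=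
        (Ideal.comap_mono bot_le).trans hC₁q
      have hle : (C₁.asIdeal ⊔ C₂.asIdeal).comap (Ideal.Quotient.mk (Ideal.ofList fs)) ≤ q := by
        refine (Ideal.comap_mono (sup_le (Ideal.le_map_of_comap_le_of_surjective _ hπ hC₁q)
          (Ideal.le_map_of_comap_le_of_surjective _ hπ hC₂q))).trans ?_
        rw [Ideal.comap_map_of_surjective' _ hπ, sup_eq_left.mpr hker]
      have h := (hnq.trans (Summit.Langlands.Langlands.Theorems.ringKrullDim_quotient_anti hle)).trans_eq
        (Summit.Langlands.Langlands.Theorems.ringKrullDim_quotient_comap_eq_of_surjective hπ _)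
      exact (not_le.mpr (H C₁ hC₁S C₂ hC₂S hC₁ hC₂)) h
    -- KEY 2: monochromatic components
    have hkey2 : ∀ P ∈ minimalPrimes A, ∀ W₁ ∈ (P ⊔ Ideal.ofList fs).minimalPrimes,
        ∀ W₂ ∈ (P ⊔ Ideal.ofList fs).minimalPrimes, RS W₁ → RT W₂ → False := by
      intro P hP W₁ hW₁ W₂ hW₂ h₁ h₂
      refine Summit.Langlands.Langlands.Theorems.false_of_reach_of_mem_minimalPrimes_sup fs RS RT
        hmonoS hmonoT hcover hkey1 (fun W hW => le_trans ?_ (hstepMin P hP W hW)) (hdom P hP)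
        hW₁ hW₂ h₁ h₂
      exact_mod_cast Nat.le_succ _
    -- both sides occur among the primes minimal over `J`
    have hS : ∃ q ∈ (Ideal.ofList fs).minimalPrimes, RS q := by
      obtain ⟨C, hCS, hC⟩ := hS₁
      exact ⟨C.asIdeal.comap (Ideal.Quotient.mk (Ideal.ofList fs)),
        Summit.Langlands.Langlands.Theorems.comap_mem_minimalPrimes_of_quotient hC, C, hCS, hC, le_rfl⟩
    have hT : ∃ q ∈ (Ideal.ofList fs).minimalPrimes, RT q := by
      obtain ⟨C, hCS, hC⟩ := hS₂
      exact ⟨C.asIdeal.comap (Ideal.Quotient.mk (Ideal.ofList fs)),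
        Summit.Langlands.Langlands.Theorems.comap_mem_minimalPrimes_of_quotient hC, C, hCS, hC, le_rfl⟩
    -- KEY 3/4, with the domain step in `A/𝔯` at `e = k + 1 − m`
    refine Summit.Langlands.Langlands.Theorems.false_of_colouring_of_reach fs hJm RS RT hmonoS hmonoT
      hcover hkey1 hkey2 hbk (fun 𝔯 h𝔯 hdim𝔯 𝔫 h𝔫 => hstep 𝔯 h𝔯 _ ?_ 𝔫 h𝔫) hS hT
    rw [show k - fs.length + 1 + fs.length = k + 1 by omega]
    exact hdim𝔯

end Summit.Langlands.Langlands.Cruxes.ReducibleOrdinaryProModular.FineSelmerCodimensionTwo
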